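import Mathlib.Tactic.Ring
import Mathlib.Tactic.LinearCombination
import Mathlib.Tactic.IntervalCases
import HarnessLib

/-!
# Venture HSemireg — THEOREM (I)'s CIRCLE REDUCTION (ENGINE-W code A, SERVICE (α), RUNG 3 (i); note P5-ALPHA-MOMENT-A.md v1.14 §2 (I)): on a centred circle `z z̄ = ρ`
# every moment monomial collapses to a power, `z^{q+m} z̄^q = ρ^q z^m` and `z^q z̄^{q+m} = ρ^q z̄^m`, so D2's non-corner conditions on equal-norm slopes are exactly the
# Vandermonde-type conditions `Σ n_i k_i^m = 0`, `|m| ≤ g − 1` (the exponent `±g` occurs only at the Weil corners) — ring identities + the finite exponent bookkeeping for `g = 4, 6, 8`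

HONEST FRAMING. Lean index of the computation cell `pub-hsemireg`, widening group ENGINE-W (code A, seat `engine-w-1`, gen 18).
RING IDENTITIES AND FINITE BOOKKEEPING ONLY. What is NOT formalised: the rank statement of THEOREM (I) (full rank 2g − 1 on 2g concyclic points), D2's criterion (by value), signed measures,
or anything object-level; nothing here says that HC, HC_CM, HC_AV or DIAG(n,d) holds. Theorems only (0 `def`, 0 named fact, 0 `sorry`). New namespace `CentredCircleMoments`. Companions:
#53 `CircleMonomialReduction` (the NON-centred circles and lines, u-dead), #49, #51, #52 (the designs), all under the same note.

SOURCE (the cell's own result, by value): `widen/ENGINE-W/out/p5alpha/P5-ALPHA-MOMENT-A.md` v1.14 §2 (I) «on |k|² = ρ one has k̄ = ρ∕k, so M_{p,q} = ρ^q Σ n_i k_i^{p−q} and the non-corner conditions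
are exactly Σ_i n_i k_i^m = 0 for |m| ≤ g − 1 (m = ±g occurs only at the Weil corners)». What the kernel holds (`z w ρ : R`, `w` for `z̄`):

* `reduce_pos` — `z·w = ρ ⟹ z^(q+m)·w^q = ρ^q·z^m`; `reduce_neg` — `z·w = ρ ⟹ z^q·w^(q+m) = ρ^q·w^m`. [kernel]
* `exponent_range` — for `g = 4, 6, 8`: for all `p, q ≤ g` with `(p,q) ∉ {(0,0),(g,0),(0,g),(g,g)}` the difference satisfies `p + 1 ≤ q + g` and `q + 1 ≤ p + g` (i.e. `|p − q| ≤ g − 1`), and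
  `|p − q| = g` happens on the square only at the two Weil corners. [kernel, `decide`]
-/

namespace Summit.Ventures.HSemireg.CentredCircleMoments

/-- **Centred circle, `p ≥ q`**: `z·w = ρ ⟹ z^(q+m)·w^q = ρ^q·z^m`. [kernel] -/
theorem reduce_pos {R : Type*} [CommRing R] (z w ρ : R) (q m : ℕ) (h : z * w = ρ) :
    z ^ (q + m) * w ^ q = ρ ^ q * z ^ m := by
  rw [← h, mul_pow]
  ring

/-- **Centred circle, `q ≥ p`**: `z·w = ρ ⟹ z^q·w^(q+m) = ρ^q·w^m`. [kernel] -/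
theorem reduce_neg {R : Type*} [CommRing R] (z w ρ : R) (q m : ℕ) (h : z * w = ρ) :
    z ^ q * w ^ (q + m) = ρ ^ q * w ^ m := by
  rw [← h, mul_pow]
  ring

/-- **Exponent bookkeeping** (`g = 4, 6, 8`): a non-corner cell `(p,q)` of `[0,g]²` has `|p − q| ≤ g − 1`, and `|p − q| = g` only at the Weil corners `(g,0), (0,g)`. [kernel, `decide`] -/
theorem exponent_range :
    (∀ p < 5, ∀ q < 5, ¬((p = 0 ∧ q = 0) ∨ (p = 4 ∧ q = 0) ∨ (p = 0 ∧ q = 4) ∨ (p = 4 ∧ q = 4)) → (p + 1 ≤ q + 4 ∧ q + 1 ≤ p + 4)) ∧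
    (∀ p < 7, ∀ q < 7, ¬((p = 0 ∧ q = 0) ∨ (p = 6 ∧ q = 0) ∨ (p = 0 ∧ q = 6) ∨ (p = 6 ∧ q = 6)) → (p + 1 ≤ q + 6 ∧ q + 1 ≤ p + 6)) ∧
    (∀ p < 9, ∀ q < 9, ¬((p = 0 ∧ q = 0) ∨ (p = 8 ∧ q = 0) ∨ (p = 0 ∧ q = 8) ∨ (p = 8 ∧ q = 8)) → (p + 1 ≤ q + 8 ∧ q + 1 ≤ p + 8)) ∧
    (∀ p < 5, ∀ q < 5, (p = q + 4 ∨ q = p + 4) → ((p = 4 ∧ q = 0) ∨ (p = 0 ∧ q = 4))) ∧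
    (∀ p < 7, ∀ q < 7, (p = q + 6 ∨ q = p + 6) → ((p = 6 ∧ q = 0) ∨ (p = 0 ∧ q = 6))) := by
  refine ⟨by decide, by decide, by decide, by decide, by decide⟩

end Summit.Ventures.HSemireg.CentredCircleMoments
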